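import Summits.Ventures.PercRepro.C041ZoneZPerZoneLemma
import Summits.Ventures.PercRepro.C041ZoneOCubeHubSum

/-!
# ROW C-041 after gen 27 — the results of the ZONE-LEMMA route in one place (p6, gen 27)

The end theorems of the twenty-five modules `C041ZoneZ*` / `C041ZoneOCube*`, restated together with every hypothesis in
the type (the referees' «tree read» form), and the state of the row's typed chain:

* THEOREM Z / Z′ (the ZONE LEMMA, abstract, with and without forced edges) — `zoneLemma_abstract`;
* CONJECTURE (INV) and the tree's ZONE LEMMA — `row_C041_theorems` (conjunction of `INVConj_holds`,
  `zoneLemma_holds` on both sides, `INVConjTailFree_holds`);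
* the crux: (O-CUBE) is the ZONE O-CUBE of the skeleton zone (`oCubeConj_iff_zoneOCube`), and on tail-free hub cores
  it follows from the per-zone ZONE O-CUBE (`oCube_nonneg_of_zoneOCube_hub`) — `row_C041_crux`.

Every statement here is a corollary of the landed modules; nothing new is claimed.  The single open statement is the
abstract `ZoneOCubeConjF` (mine-3's C-041.md §14 (a)).
-/

namespace PercRepro

namespace MultiGraph

open ZoneZ

/-- **THEOREM Z and THEOREM Z′ together**: the ZONE LEMMA on every abstract zone and on every zone with forced edges. -/
theorem zoneLemma_abstract {V E T₁ T₂ : Type*} [Fintype E] [DecidableEq E] [Fintype T₁] [DecidableEq T₁] [Fintype T₂]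
    [DecidableEq T₂] (Z : ZoneData V E T₁ T₂) (F : FZone V E T₁ T₂) (Q A : Set V) :
    (Z.Lset Q A).card ≤ (Z.Rset Q A).card ∧ (F.LsetF Q A).card ≤ (F.RsetF Q A).card :=
  ⟨Z.card_Lset_le_card_Rset Q A, F.card_LsetF_le_card_RsetF Q A⟩

/-- **The theorems of ROW C-041 below (O-CUBE)**: for a skeleton with `c` a non-terminal and distinct terminals joined by
an edge — CONJECTURE (INV), the ZONE LEMMA on both sides, and (INV) on the tail-free colourings. -/
theorem row_C041_theorems {V E : Type*} [Fintype V] [Fintype E] [DecidableEq E] (G : MultiGraph V E) (a b c : V)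
    (hc : c ≠ a ∧ c ≠ b) (hne : a ≠ b) (hab : ∃ e, G.Joins e a b) :
    G.INVConj a b c ∧ G.ZoneLemma a b c ∧ G.ZoneLemma b a c ∧ G.INVConjTailFree a b c :=
  ⟨INVConj_holds hc hne hab, zoneLemma_holds hc hne, zoneLemma_holds ⟨hc.2, hc.1⟩ hne.symm,
    INVConjTailFree_holds hc hne hab⟩

open Classical in
/-- **The crux of ROW C-041**: (O-CUBE) is the ZONE O-CUBE of the skeleton zones (anchor `c`), and on a tail-free hub
core it follows from the ZONE O-CUBE of the indexed zones. -/
theorem row_C041_crux {V E : Type*} [Fintype V] [Fintype E] [DecidableEq E] (G : MultiGraph V E) (a b c : V)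
    (hc : c ≠ a ∧ c ≠ b) (hne : a ≠ b) (hab : ∃ e, G.Joins e a b) :
    (G.OCubeConj a b c ↔ ∀ O : Config E, (G.skelZone a b O).ZoneOCubeConjF {c} {c}) ∧
      ∀ O : Config E, G.TailFree a b c O → G.HubCore a b c O →
        (∀ Z : G.ZoneIdx a b c O, (G.zoneFZ a b O Z.1).ZoneOCubeConjF (G.zoneA a b c O Z.1) (zoneQ c Z.1)) →
          0 ≤ G.oCube a b c O :=
  ⟨oCubeConj_iff_zoneOCube hc hne hab, fun _ hO hhub hzone => oCube_nonneg_of_zoneOCube_hub hc hne hab hO hhub hzone⟩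

end MultiGraph

end PercRepro
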